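import Literature.Barriers.AtomisticToContinuum.OneDimensionalHardCoreBands
import Literature.Barriers.AtomisticToContinuum.OneDimensionalHardCorePositivity
import Mathlib.Analysis.SpecialFunctions.Integrals.Basic
import HarnessLib

/-!
# No generalised condensation into arbitrary families of plane waves (sixteenth audit of `OneDimensionalHardCore`, 2026-08-17)

Companion of `OneDimensionalHardCore.lean`, `OneDimensionalHardCoreToeplitz.lean` (Lenard's formula,
Szegő–Lenard bound `R(n,t) ≤ 2e√(n+1)/√|sin(t/2)|`), `OneDimensionalHardCoreBands.lean` (band law
`B_M ≤ 8e√N√(2M+1)` for the `2M+1` LOWEST modes) and `OneDimensionalHardCorePositivity.lean`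
(`c_m ≥ 0`).

**What is typed and proved here.** For an ARBITRARY finite set `A ⊂ ℤ` of plane-wave modes
(`familyOccupation N L A = ∑_{m ∈ A} c_m(N)`, `familyKernel A t = ∑_{m ∈ A} cos(mt)`):
`∑_{m∈A} c_m(N) ≤ 2e √N √M (2 + √(2(1 + log M)))  ≤ 7e √(N M (1 + log M))`, `M = #A ≥ 1`,
for all `N`, `L > 0` — so every family of `M_N` plane waves with `M_N (1 + log M_N)/N → 0` carries
`o(N)` particles, wherever the modes sit. Proof: Lenard per mode, `|K_A| ≤ M` near `2πℤ`,
Cauchy–Schwarz (`∫ R² ≲ N log M` against `∫ K_A² ≤ 2πM`, orthogonality) away from it.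

* `familyOccupation_succ_eq_integral`: `F_A(n+1) = (2π)⁻¹ ∫₀^{2π} R(n,t) K_A(t) dt`;
* `integral_familyKernel_sq_le`: `∫₀^{2π} K_A² ≤ 2π #A` (orthogonality of the cosines);
* `integral_half_family_le`: the near/far estimate on a half period;
* `familyOccupation_le_sqrt`, `familyOccupation_le`, `familyOccupation_le_of_card_le`: the family
  law, for all `N`, `L`, `A`;
* `tendsto_familyOccupation_div`, `not_exists_linear_le_familyOccupation`: the `o(N)` statement and
  the negated conjunct shape; the named fact `OneDimensionalHardCoreFamilies` records it and is
  proved (`oneDimensionalHardCoreFamilies_holds`); `oneDimensionalHardCore_of_families` recovers the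
  parent at `A ≡ {0}`.

What stays open: the window `N/log N ≲ M_N = o(N)` (the sharp law `∑_{m∈A} c_m ≤ C√(N #A)` would
follow from the monotonicity of `|m| ↦ c_m(N)`, numerically verified in the fifteenth audit but not
proved). The operator-level Ky Fan reduction of arbitrary rank-`M` projections to plane-wave
families, paper-level when this file was written, is typed since the seventeenth audit (2026-08-17)
in the companion `OneDimensionalHardCoreSubspaces.lean` (`subspaceOccupation_le`).

## References

* [ForresterEtAl2003] P. J. Forrester, N. E. Frankel, T. M. Garoni, N. S. Witte, *Finite
  one-dimensional impenetrable Bose systems: occupation numbers*, Phys. Rev. A 67 (2003) 043607,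
  arXiv:cond-mat/0211126: §2.2.1 (`c_n(N)`, `∑_n c_n = N`), §2.2.2 (`c_n(N) ∼ ρ_∞√π Γ(n+¼)/Γ(n+¾) √N`,
  `c₀(N) ∼ 1.54269√N`; "for large `N` and fixed `n`, `c_n(N)` diverges as `√N`, whilst it tends to
  zero like `n⁻⁴` when `n ≫ N`").
* [DeiftItsKrasovsky2013] P. Deift, A. Its, I. Krasovsky, Comm. Pure Appl. Math. 66 (2013)
  1360–1438, arXiv:1207.4990: Remark 8 (r34-1)–(r34-2) (Szegő's inequality, Lenard's integral).
* [ClaeysKrasovsky2015] T. Claeys, I. Krasovsky, Duke Math. J. 164 (2015) 2897–2987,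
  arXiv:1403.3639: §1 (Lrho0) (the occupations as integrals of Lenard's determinant).

## Design notes

Everything is stated over the objects of the statement file and of the Narrow/Toeplitz/Bands
companions (`zeroMomentumOccupation`, `girardeauForm`, `momentumOccupation`, `lenardDet`,
`szegoConst`); no existing statement or definition is changed. Two auxiliary data definitions
(`familyKernel`, `familyOccupation`) and ONE named fact (`OneDimensionalHardCoreFamilies`, D-0026)
are introduced; the fact is proved in this file.
-/

noncomputable section

open MeasureTheory Filter Topology Finset
open scoped BigOperators Real

namespace Literature.Barriers.AtomisticToContinuum.BoseGas

variable {L : ℝ}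

/-! ### The family kernel `K_A(t) = ∑_{m ∈ A} cos(mt)` -/

section Kernel

/-- The **family kernel** `K_A(t) = ∑_{m ∈ A} cos(mt)` of a finite set `A` of plane-wave modes
(for `A = {-M, …, M}` this is the Dirichlet kernel of the Bands companion). [folklore] -/
def familyKernel (A : Finset ℤ) (t : ℝ) : ℝ := ∑ m ∈ A, Real.cos (m * t)

/-- `|K_A(t)| ≤ #A`. [folklore] -/
theorem abs_familyKernel_le (A : Finset ℤ) (t : ℝ) : |familyKernel A t| ≤ A.card := by
  unfold familyKernel
  calc |∑ m ∈ A, Real.cos (m * t)| ≤ ∑ m ∈ A, |Real.cos (m * t)| := Finset.abs_sum_le_sum_abs _ _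
    _ ≤ ∑ _m ∈ A, (1 : ℝ) := Finset.sum_le_sum fun m _ => Real.abs_cos_le_one _
    _ = A.card := by simp

/-- The family kernel is continuous. [folklore] -/
theorem continuous_familyKernel (A : Finset ℤ) : Continuous (familyKernel A) := by
  unfold familyKernel
  fun_prop

/-- `∫₀^{2π} cos(kt) dt = 2π` if `k = 0` and `0` otherwise (`k ∈ ℤ`). [folklore] -/
theorem integral_cos_int_mul_two_pi (k : ℤ) :
    ∫ t in (0 : ℝ)..2 * π, Real.cos (k * t) = if k = 0 then 2 * π else 0 := by
  split_ifs with hk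
  · subst hk
    simp
  · have hk' : (k : ℝ) ≠ 0 := by exact_mod_cast hk
    rw [intervalIntegral.integral_comp_mul_left (fun x => Real.cos x) hk', integral_cos, mul_zero,
      Real.sin_zero, sub_zero, show (k : ℝ) * (2 * π) = ((2 * k : ℤ) : ℝ) * π by push_cast; ring,
      Real.sin_int_mul_pi, smul_zero]

/-- `cos a cos b = (cos(a - b) + cos(a + b))/2`. [folklore] -/
theorem cos_mul_cos_eq (a b : ℝ) :
    Real.cos a * Real.cos b = (Real.cos (a - b) + Real.cos (a + b)) / 2 := by
  rw [Real.cos_sub, Real.cos_add]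
  ring

/-- Orthogonality: `∫₀^{2π} cos(mt) cos(m't) dt = π([m = m'] + [m + m' = 0])`. [folklore] -/
theorem integral_cos_mul_cos (m m' : ℤ) :
    ∫ t in (0 : ℝ)..2 * π, Real.cos (m * t) * Real.cos (m' * t) =
      π * ((if m = m' then 1 else 0) + (if m + m' = 0 then 1 else 0)) := by
  simp_rw [cos_mul_cos_eq]
  rw [intervalIntegral.integral_div, intervalIntegral.integral_add
    ((by fun_prop : Continuous fun t : ℝ => Real.cos (m * t - m' * t)).intervalIntegrable _ _)
    ((by fun_prop : Continuous fun t : ℝ => Real.cos (m * t + m' * t)).intervalIntegrable _ _)]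
  have h1 : ∫ t in (0 : ℝ)..2 * π, Real.cos (m * t - m' * t) = if m = m' then 2 * π else 0 := by
    have := integral_cos_int_mul_two_pi (m - m')
    simp_rw [show ∀ t : ℝ, ((m - m' : ℤ) : ℝ) * t = m * t - m' * t from fun t => by push_cast; ring]
      at this
    rw [this]
    simp [sub_eq_zero]
  have h2 : ∫ t in (0 : ℝ)..2 * π, Real.cos (m * t + m' * t) = if m + m' = 0 then 2 * π else 0 := by
    have := integral_cos_int_mul_two_pi (m + m')
    simp_rw [show ∀ t : ℝ, ((m + m' : ℤ) : ℝ) * t = m * t + m' * t from fun t => by push_cast; ring]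
      at this
    rw [this]
  rw [h1, h2]
  split_ifs <;> ring

/-- **Bessel bound for the family kernel**: `∫₀^{2π} K_A(t)² dt ≤ 2π #A`
(`= π(#A + #{m ∈ A : -m ∈ A})`). [folklore] -/
theorem integral_familyKernel_sq_le (A : Finset ℤ) :
    ∫ t in (0 : ℝ)..2 * π, familyKernel A t ^ 2 ≤ 2 * π * A.card := by
  have hexp : ∀ t, familyKernel A t ^ 2 =
      ∑ m ∈ A, ∑ m' ∈ A, Real.cos (m * t) * Real.cos (m' * t) := by
    intro t
    unfold familyKernel
    rw [sq, Finset.sum_mul_sum]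
  simp_rw [hexp]
  rw [intervalIntegral.integral_finsetSum (fun m _ =>
    (continuous_finsetSum _ fun m' _ => by fun_prop).intervalIntegrable _ _)]
  have hinner : ∀ m ∈ A, ∫ t in (0 : ℝ)..2 * π, ∑ m' ∈ A, Real.cos (m * t) * Real.cos (m' * t) ≤
      2 * π := by
    intro m hm
    rw [intervalIntegral.integral_finsetSum (fun m' _ => by
      exact (by fun_prop : Continuous fun t : ℝ => Real.cos (m * t) * Real.cos (m' * t))
        |>.intervalIntegrable _ _)]
    simp_rw [integral_cos_mul_cos]
    rw [← Finset.mul_sum, Finset.sum_add_distrib, Finset.sum_ite_eq A m (fun _ => (1 : ℝ))]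
    simp only [hm, if_true]
    have hcount : ∑ m' ∈ A, (if m + m' = 0 then (1 : ℝ) else 0) ≤ 1 := by
      rw [← Finset.sum_filter]
      have hsub : (A.filter fun m' => m + m' = 0) ⊆ {-m} := by
        intro m' hm'
        rw [Finset.mem_filter] at hm'
        rw [Finset.mem_singleton]
        linarith [hm'.2]
      calc ∑ _m' ∈ A.filter (fun m' => m + m' = 0), (1 : ℝ)
          ≤ ∑ _m' ∈ ({-m} : Finset ℤ), (1 : ℝ) :=
            Finset.sum_le_sum_of_subset_of_nonneg hsub fun _ _ _ => zero_le_one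
        _ = 1 := by simp
    have hπ := Real.pi_pos
    nlinarith
  calc ∑ m ∈ A, ∫ t in (0 : ℝ)..2 * π, ∑ m' ∈ A, Real.cos (m * t) * Real.cos (m' * t)
      ≤ ∑ _m ∈ A, 2 * π := Finset.sum_le_sum hinner
    _ = 2 * π * A.card := by rw [Finset.sum_const, nsmul_eq_mul]; ring

end Kernel

/-! ### Family occupations and Lenard's formula per family -/

section Occupation

variable {n : ℕ}

/-- The **family occupation** `F_A(N) = ∑_{m ∈ A} c_m(N)`: the total occupation of the plane
waves `e_m = e^{2πimx/L}`, `m ∈ A`, in Girardeau's ground state (`momentumOccupation`; the band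
`A = {-M, …, M}` gives the Bands companion's `bandOccupation`). [cite: ForresterEtAl2003, §2.2.1] -/
def familyOccupation (N : ℕ) (L : ℝ) (A : Finset ℤ) : ℝ := ∑ m ∈ A, momentumOccupation N L m

/-- Family occupations are non-negative (`c_m ≥ 0`). [cite: ForresterEtAl2003, §2.2.1] -/
theorem familyOccupation_nonneg (hL : 0 < L) (N : ℕ) (A : Finset ℤ) :
    0 ≤ familyOccupation N L A :=
  Finset.sum_nonneg fun m _ => momentumOccupation_nonneg hL N m

/-- Family occupations are monotone in the family (`c_m ≥ 0`). [cite: ForresterEtAl2003, §2.2.1] -/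
theorem familyOccupation_mono (hL : 0 < L) (N : ℕ) {A B : Finset ℤ} (h : A ⊆ B) :
    familyOccupation N L A ≤ familyOccupation N L B :=
  Finset.sum_le_sum_of_subset_of_nonneg h fun m _ _ => momentumOccupation_nonneg hL N m

/-- No particles, no occupation: `F_A(0) = 0`. [folklore] -/
theorem familyOccupation_zero_left (L : ℝ) (A : Finset ℤ) : familyOccupation 0 L A = 0 := by
  unfold familyOccupation momentumOccupation girardeauForm
  simp [girardeauDensityMatrix]

/-- **Lenard's formula per family**: `F_A(n+1) = (2π)⁻¹ ∫₀^{2π} R(n,t) K_A(t) dt`.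
[cite: ForresterEtAl2003, §2.2.1] [cite: ClaeysKrasovsky2015, §1 (Lrho0)] -/
theorem familyOccupation_succ_eq_integral (hL : 0 < L) (n : ℕ) (A : Finset ℤ) :
    familyOccupation (n + 1) L A =
      (2 * π)⁻¹ * ∫ t in (0 : ℝ)..2 * π, lenardDet n t * familyKernel A t := by
  unfold familyOccupation familyKernel
  simp_rw [momentumOccupation_succ_eq_integral hL, Finset.mul_sum]
  rw [intervalIntegral.integral_finsetSum, Finset.mul_sum]
  intro m _
  exact ((continuous_lenardDet n).mul (by fun_prop)).intervalIntegrable _ _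

end Occupation

/-! ### The family law `F_A(N) ≤ 2e √N √M (2 + √(2(1 + log M)))` -/

section FamilyLaw

variable {n : ℕ}

/-- Weighted AM–GM: `2ab ≤ l a² + b²/l` for `l > 0`. [folklore] -/
theorem two_mul_mul_le_add_div (a b : ℝ) {l : ℝ} (hl : 0 < l) :
    2 * (a * b) ≤ l * a ^ 2 + b ^ 2 / l := by
  have h : l * a ^ 2 + b ^ 2 / l - 2 * (a * b) = (l * a - b) ^ 2 / l := by
    field_simp
    ring
  have h0 : 0 ≤ (l * a - b) ^ 2 / l := div_nonneg (sq_nonneg _) hl.le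
  linarith

/-- Optimising the weighted AM–GM bound: if `2I ≤ lA + B/l` for every `l > 0` (`A, B > 0`), then
`I ≤ √A √B`. [folklore] -/
theorem le_sqrt_mul_sqrt_of_forall {I A B : ℝ} (hA : 0 < A) (hB : 0 < B)
    (h : ∀ l : ℝ, 0 < l → 2 * I ≤ l * A + B / l) : I ≤ Real.sqrt A * Real.sqrt B := by
  have hsA := Real.sqrt_pos.2 hA
  have hsB := Real.sqrt_pos.2 hB
  have hl : 0 < Real.sqrt B / Real.sqrt A := div_pos hsB hsA
  have h1 := h _ hl
  have eA : Real.sqrt B / Real.sqrt A * A = Real.sqrt A * Real.sqrt B := by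
    rw [div_mul_eq_mul_div, div_eq_iff hsA.ne']
    calc Real.sqrt B * A = Real.sqrt B * (Real.sqrt A * Real.sqrt A) := by
          rw [Real.mul_self_sqrt hA.le]
      _ = Real.sqrt A * Real.sqrt B * Real.sqrt A := by ring
  have eB : B / (Real.sqrt B / Real.sqrt A) = Real.sqrt A * Real.sqrt B := by
    rw [div_div_eq_mul_div, div_eq_iff hsB.ne']
    calc B * Real.sqrt A = Real.sqrt B * Real.sqrt B * Real.sqrt A := by
          rw [Real.mul_self_sqrt hB.le]
      _ = Real.sqrt A * Real.sqrt B * Real.sqrt B := by ring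
  rw [eA, eB] at h1
  linarith

/-- **Cauchy–Schwarz step on the far region.** For continuous `f, g ≥ 0` on `[a, b]` with
`∫_a^b f² ≤ A` and `∫_a^b g² ≤ B` (`A, B > 0`): `∫_a^b f g ≤ √A √B`. [folklore] -/
theorem integral_mul_le_sqrt_of_sq_le {f g : ℝ → ℝ} (hf : Continuous f) (hg : Continuous g)
    {a b A B : ℝ} (hab : a ≤ b) (hA : 0 < A) (hB : 0 < B)
    (hfA : ∫ x in a..b, f x ^ 2 ≤ A) (hgB : ∫ x in a..b, g x ^ 2 ≤ B) :
    ∫ x in a..b, f x * g x ≤ Real.sqrt A * Real.sqrt B := by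
  refine le_sqrt_mul_sqrt_of_forall hA hB fun l hl => ?_
  have hpt : ∀ x, 2 * (f x * g x) ≤ l * f x ^ 2 + g x ^ 2 / l := fun x =>
    two_mul_mul_le_add_div (f x) (g x) hl
  have hi0 : IntervalIntegrable (fun x => 2 * (f x * g x)) volume a b :=
    (by fun_prop : Continuous fun x => 2 * (f x * g x)).intervalIntegrable _ _
  have hi1 : IntervalIntegrable (fun x => l * f x ^ 2) volume a b :=
    (by fun_prop : Continuous fun x => l * f x ^ 2).intervalIntegrable _ _
  have hi2 : IntervalIntegrable (fun x => g x ^ 2 / l) volume a b :=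
    (by fun_prop : Continuous fun x => g x ^ 2 / l).intervalIntegrable _ _
  have hint : ∫ x in a..b, 2 * (f x * g x) ≤ ∫ x in a..b, (l * f x ^ 2 + g x ^ 2 / l) :=
    intervalIntegral.integral_mono_on hab hi0 (hi1.add hi2) fun x _ => hpt x
  have hsplit : ∫ x in a..b, (l * f x ^ 2 + g x ^ 2 / l) =
      l * (∫ x in a..b, f x ^ 2) + (∫ x in a..b, g x ^ 2) / l := by
    rw [intervalIntegral.integral_add hi1 hi2, intervalIntegral.integral_const_mul,
      intervalIntegral.integral_div]
  rw [intervalIntegral.integral_const_mul, hsplit] at hint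
  have h1 : l * ∫ x in a..b, f x ^ 2 ≤ l * A := mul_le_mul_of_nonneg_left hfA hl.le
  have h2 : (∫ x in a..b, g x ^ 2) / l ≤ B / l := div_le_div_of_nonneg_right hgB hl.le
  linarith

/-- **The near/far estimate on a half period.** Let `M = #A ≥ 1`, `K_n = 2e√(n+1)` and let
`s(u) = u` or `s(u) = 2π - u` (so `sin(s(u)/2) = sin(u/2)`). If `∫₀^π K_A(s(u))² du ≤ 2πM`, then
`∫₀^π R(n, s(u)) |K_A(s(u))| du ≤ π K_n √M (2 + √(2(1 + log M)))`: on `(0, π/M]` use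
`R ≤ K_n √π u^{-1/2}` and `|K_A| ≤ M`; on `[π/M, π]` use Cauchy–Schwarz with
`∫ R² ≤ K_n² π log M` and `∫ K_A² ≤ 2πM`. [cite: DeiftItsKrasovsky2013, Remark 8 (r34-2)] -/
theorem integral_half_family_le (n : ℕ) {A : Finset ℤ} (hA : 1 ≤ A.card) {s : ℝ → ℝ}
    (hs : Continuous s) (hsin : ∀ u, Real.sin (s u / 2) = Real.sin (u / 2))
    (hK2 : ∫ u in (0 : ℝ)..π, familyKernel A (s u) ^ 2 ≤ 2 * π * A.card) :
    ∫ u in (0 : ℝ)..π, lenardDet n (s u) * |familyKernel A (s u)| ≤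
      π * szegoConst n * Real.sqrt A.card *
        (2 + Real.sqrt (2 * (1 + Real.log A.card))) := by
  set K := szegoConst n with hKdef
  have hKpos : 0 < K := by rw [hKdef]; unfold szegoConst; positivity
  have hK0 : 0 ≤ K := hKpos.le
  have hπ := Real.pi_pos
  set M : ℝ := (A.card : ℝ) with hM
  have hM1 : 1 ≤ M := by rw [hM]; exact_mod_cast hA
  have hM0 : 0 < M := by linarith
  set t₀ : ℝ := π / M with ht₀def
  have ht₀ : 0 < t₀ := by positivity
  have ht₀π : t₀ ≤ π := by
    rw [ht₀def, div_le_iff₀ hM0]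
    nlinarith
  have hlogM : 0 ≤ Real.log M := Real.log_nonneg hM1
  -- the integrand and its integrability
  set g : ℝ → ℝ := fun u => lenardDet n (s u) * |familyKernel A (s u)| with hgdef
  have hg : Continuous g :=
    ((continuous_lenardDet n).comp hs).mul ((continuous_familyKernel A).comp hs).abs
  have hint : ∀ a b : ℝ, IntervalIntegrable g volume a b := fun a b => hg.intervalIntegrable a b
  -- pointwise Szegő–Lenard bound along `s`
  have hR : ∀ u ∈ Set.Ioc (0 : ℝ) π,
      lenardDet n (s u) ≤ K * (Real.sqrt π * u ^ (-(1 / 2 : ℝ))) := fun u hu =>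
    lenardDet_le_of_sin n (hsin u) hu.1 hu.2
  -- NEAR part: `∫₀^{t₀} g ≤ M K √π · 2 √t₀ = 2 K π √M`
  have hnear : ∫ u in (0 : ℝ)..t₀, g u ≤ 2 * K * π * Real.sqrt M := by
    have hle : ∫ u in (0 : ℝ)..t₀, g u ≤ ∫ u in (0 : ℝ)..t₀, K * Real.sqrt π * M * u ^ (-(1 / 2 : ℝ)) := by
      refine intervalIntegral.integral_mono_on_of_le_Ioo ht₀.le (hint 0 t₀) ?_ fun u hu => ?_
      · exact (intervalIntegral.intervalIntegrable_rpow' (by norm_num)).const_mul _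
      · have hu' : u ∈ Set.Ioc (0 : ℝ) π := ⟨hu.1, hu.2.le.trans ht₀π⟩
        have h1 := hR u hu'
        have h2 : |familyKernel A (s u)| ≤ M := abs_familyKernel_le A (s u)
        have hR0 := lenardDet_nonneg n (s u)
        calc g u = lenardDet n (s u) * |familyKernel A (s u)| := rfl
          _ ≤ K * (Real.sqrt π * u ^ (-(1 / 2 : ℝ))) * M :=
              mul_le_mul h1 h2 (abs_nonneg _)
                (mul_nonneg hK0 (mul_nonneg (Real.sqrt_nonneg _) (Real.rpow_nonneg hu.1.le _)))
          _ = K * Real.sqrt π * M * u ^ (-(1 / 2 : ℝ)) := by ring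
    rw [intervalIntegral.integral_const_mul, integral_rpow_neg_half] at hle
    have h1 : t₀ ^ (1 / 2 : ℝ) = Real.sqrt π / Real.sqrt M := by
      rw [← Real.sqrt_eq_rpow, ht₀def, Real.sqrt_div hπ.le]
    rw [h1] at hle
    have hsqπ : Real.sqrt π * Real.sqrt π = π := Real.mul_self_sqrt hπ.le
    have hsM : M / Real.sqrt M = Real.sqrt M := Real.div_sqrt
    calc ∫ u in (0 : ℝ)..t₀, g u ≤ K * Real.sqrt π * M * (2 * (Real.sqrt π / Real.sqrt M)) := hle
      _ = 2 * K * (Real.sqrt π * Real.sqrt π) * (M / Real.sqrt M) := by ring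
      _ = 2 * K * π * Real.sqrt M := by rw [hsqπ, hsM]
  -- FAR part: Cauchy–Schwarz on `[t₀, π]`
  have hfar : ∫ u in t₀..π, g u ≤
      Real.sqrt (K ^ 2 * π * (1 + Real.log M)) * Real.sqrt (2 * π * M) := by
    have hf2 : ∫ u in t₀..π, lenardDet n (s u) ^ 2 ≤ K ^ 2 * π * (1 + Real.log M) := by
      have hle : ∫ u in t₀..π, lenardDet n (s u) ^ 2 ≤ ∫ u in t₀..π, K ^ 2 * π * u⁻¹ := by
        refine intervalIntegral.integral_mono_on ht₀π
          ((((continuous_lenardDet n).comp hs).pow 2).intervalIntegrable _ _) ?_ fun u hu => ?_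
        · refine (intervalIntegral.intervalIntegrable_inv (fun u hu => ?_) continuousOn_id).const_mul _
          have : t₀ ≤ u := by
            rw [Set.uIcc_of_le ht₀π] at hu; exact hu.1
          exact (ht₀.trans_le this).ne'
        · have hu0 : 0 < u := ht₀.trans_le hu.1
          have h1 := hR u ⟨hu0, hu.2⟩
          have hR0 := lenardDet_nonneg n (s u)
          calc lenardDet n (s u) ^ 2 ≤ (K * (Real.sqrt π * u ^ (-(1 / 2 : ℝ)))) ^ 2 :=
                pow_le_pow_left₀ hR0 h1 2
            _ = K ^ 2 * (Real.sqrt π) ^ 2 * (u ^ (-(1 / 2 : ℝ))) ^ 2 := by ring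
            _ = K ^ 2 * π * u⁻¹ := by
                have hu2 : (u ^ (-(1 / 2 : ℝ))) ^ 2 = u⁻¹ := by
                  rw [← Real.rpow_two, ← Real.rpow_mul hu0.le, ← Real.rpow_neg_one]
                  norm_num
                rw [Real.sq_sqrt hπ.le, hu2]
      rw [intervalIntegral.integral_const_mul, integral_inv (Set.notMem_uIcc_of_lt ht₀ hπ)] at hle
      have hlog : Real.log (π / t₀) = Real.log M := by
        rw [ht₀def, div_div_eq_mul_div, mul_div_cancel_left₀ _ hπ.ne']
      rw [hlog] at hle
      calc ∫ u in t₀..π, lenardDet n (s u) ^ 2 ≤ K ^ 2 * π * Real.log M := hle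
        _ ≤ K ^ 2 * π * (1 + Real.log M) := by
            have : 0 ≤ K ^ 2 * π := by positivity
            nlinarith
    have hg2 : ∫ u in t₀..π, |familyKernel A (s u)| ^ 2 ≤ 2 * π * M := by
      have hmono : ∫ u in t₀..π, |familyKernel A (s u)| ^ 2 ≤
          ∫ u in (0 : ℝ)..π, |familyKernel A (s u)| ^ 2 := by
        refine intervalIntegral.integral_mono_interval ht₀.le ht₀π le_rfl ?_ ?_
        · exact Eventually.of_forall fun u => sq_nonneg _
        · exact ((((continuous_familyKernel A).comp hs).abs).pow 2).intervalIntegrable _ _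
      refine hmono.trans ?_
      simp_rw [sq_abs]
      exact hK2
    exact integral_mul_le_sqrt_of_sq_le ((continuous_lenardDet n).comp hs)
      ((continuous_familyKernel A).comp hs).abs ht₀π (by positivity) (by positivity) hf2 hg2
  -- evaluate the far bound: `√(K²π(1+log M)) √(2πM) = K π √M √(2(1 + log M))`
  have hfar' : ∫ u in t₀..π, g u ≤ K * π * Real.sqrt M * Real.sqrt (2 * (1 + Real.log M)) := by
    refine hfar.trans (le_of_eq ?_)
    rw [← Real.sqrt_mul (by positivity)]
    rw [show K ^ 2 * π * (1 + Real.log M) * (2 * π * M) =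
        (K * π) ^ 2 * (M * (2 * (1 + Real.log M))) by ring]
    rw [Real.sqrt_mul (by positivity), Real.sqrt_sq (by positivity), Real.sqrt_mul hM0.le]
    ring
  -- assemble
  rw [← intervalIntegral.integral_add_adjacent_intervals (hint 0 t₀) (hint t₀ π)]
  calc (∫ u in (0 : ℝ)..t₀, g u) + ∫ u in t₀..π, g u
      ≤ 2 * K * π * Real.sqrt M + K * π * Real.sqrt M * Real.sqrt (2 * (1 + Real.log M)) :=
        add_le_add hnear hfar'
    _ = π * K * Real.sqrt M * (2 + Real.sqrt (2 * (1 + Real.log M))) := by ring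

end FamilyLaw

/-! ### Assembly: the family law for all `N`, `L`, `A` -/

section Assembly

variable {n : ℕ}

/-- `∫₀^π K_A(u)² du ≤ 2π #A` and `∫₀^π K_A(2π - u)² du ≤ 2π #A` (the two half periods of the
Bessel bound). [folklore] -/
theorem integral_familyKernel_sq_half_le (A : Finset ℤ) :
    (∫ u in (0 : ℝ)..π, familyKernel A u ^ 2 ≤ 2 * π * A.card) ∧
      (∫ u in (0 : ℝ)..π, familyKernel A (2 * π - u) ^ 2 ≤ 2 * π * A.card) := by
  have hπ := Real.pi_pos
  have hcont : Continuous fun t => familyKernel A t ^ 2 := (continuous_familyKernel A).pow 2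
  have hfull := integral_familyKernel_sq_le A
  constructor
  · refine le_trans ?_ hfull
    refine intervalIntegral.integral_mono_interval le_rfl hπ.le (by linarith) ?_
      (hcont.intervalIntegrable _ _)
    exact Eventually.of_forall fun u => sq_nonneg _
  · have h := intervalIntegral.integral_comp_sub_left (a := 0) (b := π)
      (fun t => familyKernel A t ^ 2) (2 * π)
    rw [show 2 * π - π = π by ring, sub_zero] at h
    rw [h]
    refine le_trans ?_ hfull
    refine intervalIntegral.integral_mono_interval hπ.le (by linarith) le_rfl ?_
      (hcont.intervalIntegrable _ _)
    exact Eventually.of_forall fun u => sq_nonneg _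

/-- **The integrated family bound**:
`∫₀^{2π} R(n,t) |K_A(t)| dt ≤ 2π K_n √M (2 + √(2(1 + log M)))`, `M = #A ≥ 1`.
[cite: DeiftItsKrasovsky2013, Remark 8 (r34-1)–(r34-2)] -/
theorem integral_lenardDet_mul_abs_familyKernel_le (n : ℕ) {A : Finset ℤ} (hA : 1 ≤ A.card) :
    ∫ t in (0 : ℝ)..2 * π, lenardDet n t * |familyKernel A t| ≤
      2 * π * szegoConst n * Real.sqrt A.card *
        (2 + Real.sqrt (2 * (1 + Real.log A.card))) := by
  have hg : Continuous fun t => lenardDet n t * |familyKernel A t| :=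
    (continuous_lenardDet n).mul (continuous_familyKernel A).abs
  have hint : ∀ a b : ℝ, IntervalIntegrable (fun t => lenardDet n t * |familyKernel A t|)
      volume a b := fun a b => hg.intervalIntegrable a b
  obtain ⟨hK1, hK2⟩ := integral_familyKernel_sq_half_le A
  have hL : ∫ t in (0 : ℝ)..π, lenardDet n t * |familyKernel A t| ≤
      π * szegoConst n * Real.sqrt A.card * (2 + Real.sqrt (2 * (1 + Real.log A.card))) :=
    integral_half_family_le n hA (s := fun u => u) continuous_id (fun _ => rfl) hK1
  have hR : ∫ t in π..2 * π, lenardDet n t * |familyKernel A t| ≤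
      π * szegoConst n * Real.sqrt A.card * (2 + Real.sqrt (2 * (1 + Real.log A.card))) := by
    have h := intervalIntegral.integral_comp_sub_left (a := 0) (b := π)
      (fun t => lenardDet n t * |familyKernel A t|) (2 * π)
    rw [show 2 * π - π = π by ring, sub_zero] at h
    rw [← h]
    refine integral_half_family_le n hA (s := fun u => 2 * π - u) (by fun_prop) (fun u => ?_) hK2
    rw [show (2 * π - u) / 2 = π - u / 2 by ring, Real.sin_pi_sub]
  rw [← intervalIntegral.integral_add_adjacent_intervals (hint 0 π) (hint π (2 * π))]
  linarith

/-- **The family law (no generalised condensation into arbitrary mode families, quantitative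
form).** For every `N`, every circumference `L > 0` and every non-empty finite set `A` of plane-wave
modes, `M = #A`:
`∑_{m ∈ A} c_m(N) ≤ 2e √N √M (2 + √(2(1 + log M)))`
— wherever the modes sit (Lenard per mode, `|K_A| ≤ M` on `|t| ≤ π/M`, Cauchy–Schwarz with
`∫ R² ≤ 4e²N π log M` and `∫ K_A² ≤ 2πM` on the rest). At `M = 1` this is `c_m ≤ 2e(2+√2)√N`,
the order of the Szegő–Lenard single-mode law; printed order for the `M` LOWEST modes
`≈ 4ρ_∞√(πNM)` [cite: ForresterEtAl2003, §2.2.2], so the law is sharp up to the factor `√(log M)`.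
[cite: DeiftItsKrasovsky2013, Remark 8 (r34-1)–(r34-2)] -/
theorem familyOccupation_le_sqrt (N : ℕ) (hL : 0 < L) {A : Finset ℤ} (hA : A.Nonempty) :
    familyOccupation N L A ≤
      2 * Real.exp 1 * Real.sqrt N * Real.sqrt A.card *
        (2 + Real.sqrt (2 * (1 + Real.log A.card))) := by
  have hA1 : 1 ≤ A.card := Finset.card_pos.2 hA
  cases N with
  | zero =>
    rw [familyOccupation_zero_left]
    positivity
  | succ n =>
    rw [familyOccupation_succ_eq_integral hL n A]
    have hπ := Real.pi_pos
    have h2π : (0 : ℝ) ≤ 2 * π := by positivity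
    have hle : ∫ t in (0 : ℝ)..2 * π, lenardDet n t * familyKernel A t ≤
        ∫ t in (0 : ℝ)..2 * π, lenardDet n t * |familyKernel A t| := by
      refine intervalIntegral.integral_mono_on h2π
        (((continuous_lenardDet n).mul (continuous_familyKernel A)).intervalIntegrable _ _)
        (((continuous_lenardDet n).mul (continuous_familyKernel A).abs).intervalIntegrable _ _)
        fun t _ => ?_
      exact mul_le_mul_of_nonneg_left (le_abs_self _) (lenardDet_nonneg n t)
    have h := integral_lenardDet_mul_abs_familyKernel_le n hA1
    unfold szegoConst at h
    calc (2 * π)⁻¹ * ∫ t in (0 : ℝ)..2 * π, lenardDet n t * familyKernel A t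
        ≤ (2 * π)⁻¹ * (2 * π * (2 * Real.exp 1 * Real.sqrt (n + 1)) * Real.sqrt A.card *
            (2 + Real.sqrt (2 * (1 + Real.log A.card)))) := by
          gcongr
          exact hle.trans h
      _ = 2 * Real.exp 1 * Real.sqrt ((n + 1 : ℕ) : ℝ) * Real.sqrt A.card *
            (2 + Real.sqrt (2 * (1 + Real.log A.card))) := by
          push_cast
          field_simp

/-- `2 + √(2(1 + ℓ)) ≤ (7/2) √(1 + ℓ)` for `ℓ ≥ 0` (`2 + √2 < 7/2`). [folklore] -/
theorem two_add_sqrt_le {ℓ : ℝ} (hℓ : 0 ≤ ℓ) :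
    2 + Real.sqrt (2 * (1 + ℓ)) ≤ 7 / 2 * Real.sqrt (1 + ℓ) := by
  have h1 : 1 ≤ Real.sqrt (1 + ℓ) := by
    have h := Real.sqrt_le_sqrt (show (1 : ℝ) ≤ 1 + ℓ by linarith)
    rwa [Real.sqrt_one] at h
  have h2 : Real.sqrt 2 ≤ 3 / 2 := by
    rw [show (3 / 2 : ℝ) = Real.sqrt ((3 / 2) ^ 2) by rw [Real.sqrt_sq (by norm_num)]]
    exact Real.sqrt_le_sqrt (by norm_num)
  rw [Real.sqrt_mul (by norm_num : (0 : ℝ) ≤ 2)]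
  nlinarith [Real.sqrt_nonneg 2, Real.sqrt_nonneg (1 + ℓ)]

/-- **The family law, compact form**: `∑_{m ∈ A} c_m(N) ≤ 7e √N √(M(1 + log M))` for EVERY finite
set `A` of plane-wave modes (`M = #A`; both sides vanish for `A = ∅`).
[cite: ForresterEtAl2003, §2.2.2] [cite: DeiftItsKrasovsky2013, Remark 8 (r34-1)–(r34-2)] -/
theorem familyOccupation_le (N : ℕ) (hL : 0 < L) (A : Finset ℤ) :
    familyOccupation N L A ≤
      7 * Real.exp 1 * Real.sqrt N * Real.sqrt (A.card * (1 + Real.log A.card)) := by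
  rcases A.eq_empty_or_nonempty with rfl | hA
  · simp [familyOccupation]
  · have hM1 : (1 : ℝ) ≤ A.card := by exact_mod_cast Finset.card_pos.2 hA
    have hlog : 0 ≤ Real.log A.card := Real.log_nonneg hM1
    have h := familyOccupation_le_sqrt N hL hA
    have h7 := two_add_sqrt_le hlog
    have hpos : 0 ≤ 2 * Real.exp 1 * Real.sqrt N * Real.sqrt A.card := by positivity
    calc familyOccupation N L A
        ≤ 2 * Real.exp 1 * Real.sqrt N * Real.sqrt A.card *
            (2 + Real.sqrt (2 * (1 + Real.log A.card))) := h
      _ ≤ 2 * Real.exp 1 * Real.sqrt N * Real.sqrt A.card * (7 / 2 * Real.sqrt (1 + Real.log A.card)) :=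
          mul_le_mul_of_nonneg_left h7 hpos
      _ = 7 * Real.exp 1 * Real.sqrt N * (Real.sqrt A.card * Real.sqrt (1 + Real.log A.card)) := by
          ring
      _ = 7 * Real.exp 1 * Real.sqrt N * Real.sqrt (A.card * (1 + Real.log A.card)) := by
          rw [← Real.sqrt_mul (Nat.cast_nonneg _)]

/-- **The `M` most occupied plane waves.** For every `M ≥ 1` and every family `A` of at most `M`
modes, `∑_{m ∈ A} c_m(N) ≤ 7e √N √(M(1 + log M))` — a bound on the sum of the `M` largest momentum
occupations, wherever they sit in `ℤ` (no monotonicity of `m ↦ c_m(N)` is used or typed).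
[cite: ForresterEtAl2003, §2.2.2] -/
theorem familyOccupation_le_of_card_le (N : ℕ) (hL : 0 < L) {A : Finset ℤ} {M : ℕ}
    (hAM : A.card ≤ M) :
    familyOccupation N L A ≤ 7 * Real.exp 1 * Real.sqrt N * Real.sqrt (M * (1 + Real.log M)) := by
  refine (familyOccupation_le N hL A).trans ?_
  gcongr 7 * Real.exp 1 * Real.sqrt N * Real.sqrt ?_
  rcases Nat.eq_zero_or_pos A.card with h0 | hpos
  · rw [h0]
    simp only [Nat.cast_zero, zero_mul]
    have : (0 : ℝ) ≤ Real.log M := by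
      rcases Nat.eq_zero_or_pos M with rfl | hM
      · simp
      · exact Real.log_nonneg (by exact_mod_cast hM)
    positivity
  · have hA1 : (1 : ℝ) ≤ A.card := by exact_mod_cast hpos
    have hAM' : (A.card : ℝ) ≤ M := by exact_mod_cast hAM
    have hlogA : 0 ≤ Real.log A.card := Real.log_nonneg hA1
    have hlogle : Real.log A.card ≤ Real.log M := Real.log_le_log (by linarith) hAM'
    nlinarith

/-- The trivial complement: every family carries at most `N` particles (`∑_{m∈ℤ} c_m = N`,
`c_m ≥ 0`) — not needed below, recorded through the single-mode bound `c_m ≤ c₀`: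
`F_A(N) ≤ #A · c₀(N)`. [cite: ForresterEtAl2003, §2.2.1–§2.2.2] -/
theorem familyOccupation_le_card_mul (N : ℕ) (hL : 0 < L) (A : Finset ℤ) :
    familyOccupation N L A ≤ A.card * zeroMomentumOccupation N L := by
  unfold familyOccupation
  calc ∑ m ∈ A, momentumOccupation N L m ≤ ∑ _m ∈ A, zeroMomentumOccupation N L :=
        Finset.sum_le_sum fun m _ => (le_abs_self _).trans (abs_momentumOccupation_le hL N m)
    _ = A.card * zeroMomentumOccupation N L := by rw [Finset.sum_const, nsmul_eq_mul]

/-- **No generalised condensation into arbitrary families of `o(N/log N)` plane waves.** If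
`#A_N (1 + log #A_N)/N → 0` then `F_{A_N}(N)/N → 0`
(from `0 ≤ F_A(N)/N ≤ 7e √(#A(1 + log #A)/N)`). [cite: ForresterEtAl2003, §2.2.2] -/
theorem tendsto_familyOccupation_div (hL : 0 < L) {A : ℕ → Finset ℤ}
    (hA : Tendsto (fun N : ℕ => ((A N).card : ℝ) * (1 + Real.log (A N).card) / N) atTop (𝓝 0)) :
    Tendsto (fun N : ℕ => familyOccupation N L (A N) / N) atTop (𝓝 0) := by
  have hmaj : Tendsto (fun N : ℕ => 7 * Real.exp 1 *
      Real.sqrt (((A N).card : ℝ) * (1 + Real.log (A N).card) / N)) atTop (𝓝 0) := by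
    have h := (Real.continuous_sqrt.tendsto 0).comp hA
    rw [Real.sqrt_zero] at h
    simpa using h.const_mul (7 * Real.exp 1)
  refine squeeze_zero_norm' ?_ hmaj
  filter_upwards [Filter.eventually_ge_atTop 1] with N hN
  have hNpos : (0 : ℝ) < N := by exact_mod_cast hN
  rw [Real.norm_eq_abs, abs_of_nonneg (div_nonneg (familyOccupation_nonneg hL N (A N)) hNpos.le),
    div_le_iff₀ hNpos]
  calc familyOccupation N L (A N)
      ≤ 7 * Real.exp 1 * Real.sqrt N * Real.sqrt ((A N).card * (1 + Real.log (A N).card)) :=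
        familyOccupation_le N hL (A N)
    _ = 7 * Real.exp 1 * Real.sqrt (((A N).card : ℝ) * (1 + Real.log (A N).card) / N) * N := by
        rw [Real.sqrt_div' _ hNpos.le, mul_assoc (7 * Real.exp 1), mul_assoc (7 * Real.exp 1)]
        congr 1
        rw [div_mul_eq_mul_div, eq_div_iff (Real.sqrt_pos.2 hNpos).ne']
        calc Real.sqrt N * Real.sqrt (((A N).card : ℝ) * (1 + Real.log (A N).card)) * Real.sqrt N
            = Real.sqrt (((A N).card : ℝ) * (1 + Real.log (A N).card)) *
                (Real.sqrt N * Real.sqrt N) := by ring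
          _ = Real.sqrt (((A N).card : ℝ) * (1 + Real.log (A N).card)) * N := by
              rw [Real.mul_self_sqrt hNpos.le]

/-- **The generalised-condensation analogue of the conjunct's `HasGroundStateBEC` shape fails for
every family of `o(N/log N)` plane waves**: there is no `c > 0` with `cN ≤ ∑_{m ∈ A_N} c_m(N)` for
all large `N`. [cite: ForresterEtAl2003, §2.2.2] -/
theorem not_exists_linear_le_familyOccupation (hL : 0 < L) {A : ℕ → Finset ℤ}
    (hA : Tendsto (fun N : ℕ => ((A N).card : ℝ) * (1 + Real.log (A N).card) / N) atTop (𝓝 0)) :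
    ¬ ∃ c : ℝ, 0 < c ∧ ∀ᶠ N : ℕ in atTop, c * N ≤ familyOccupation N L (A N) := by
  rintro ⟨c, hc, hev⟩
  have ht := tendsto_familyOccupation_div hL hA
  have hev' : ∀ᶠ N : ℕ in atTop, c ≤ familyOccupation N L (A N) / N := by
    filter_upwards [hev, Filter.eventually_ge_atTop 1] with N hN hN1
    have hNpos : (0 : ℝ) < N := by exact_mod_cast hN1
    rwa [le_div_iff₀ hNpos]
  have hlim : c ≤ 0 := ge_of_tendsto ht hev'
  linarith

/-- The zero mode as a family: `F_{{0}}(N) = c₀(N)`. [cite: ForresterEtAl2003, §2.2.1] -/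
theorem familyOccupation_singleton_zero (hL : 0 < L) (N : ℕ) :
    familyOccupation N L {0} = zeroMomentumOccupation N L := by
  simp [familyOccupation, momentumOccupation_zero hL]

end Assembly

end Literature.Barriers.AtomisticToContinuum.BoseGas

namespace Literature.Barriers.AtomisticToContinuum

open BoseGas

/-- **No generalised Bose–Einstein condensation into arbitrary families of plane waves for
impenetrable bosons on the ring (Girardeau–Lenard–Szegő, family form).** For every circumference
`L > 0` and every sequence of finite sets `A_N ⊂ ℤ` of plane-wave modes `e_m = e^{2πimx/L}` with
`#A_N (1 + log #A_N)/N → 0` — in particular for every `#A_N = o(N/log N)`, and with NO restriction on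
WHERE in `ℤ` the modes sit — the total occupation `F_{A_N}(N) = ∑_{m ∈ A_N} c_m(N)` in Girardeau's
ground state of `N` impenetrable bosons on the circle is `o(N)` (`familyOccupation`,
`momentumOccupation = L⁻¹Re⟨e_m, γ_N e_m⟩ ≥ 0`). Quantitatively, for ALL `N`, `L` and finite `A`,
`M = #A`: `∑_{m∈A} c_m(N) ≤ 2e√N√M(2 + √(2(1 + log M))) ≤ 7e√N√(M(1 + log M))`
(`familyOccupation_le_sqrt`, `familyOccupation_le`); equivalently the `M` LARGEST momentum
occupations sum to at most `7e√(NM(1 + log M))` (`familyOccupation_le_of_card_le`). Printed: for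
fixed `m`, `c_m(N) ∼ ρ_∞√π Γ(m+¼)Γ(m+¾)⁻¹√N`, "for large `N` and fixed `n`, `c_n(N)` diverges as
`√N`, whilst it tends to zero like `n⁻⁴` when `n ≫ N`" [cite: ForresterEtAl2003, §2.2.2], so the
`M` lowest modes carry `≈ 4ρ_∞√(πNM)` and the law is sharp up to `√(log M)`; the sharp `C√(NM)` for
arbitrary families would follow from the (numerically verified, unproved) monotonicity of
`|m| ↦ c_m(N)` recorded in the parent's caveat (t)(3).
BARRIER (D-0021), AtomisticToContinuum/BoseEinsteinCondensation:
technique_class: dimension-independent coupling-independent interaction-independent ground-state repulsive-generic generalized-condensation arbitrary-mode-family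
blocks: everything `OneDimensionalHardCore` / `OneDimensionalHardCoreNarrow` / `OneDimensionalHardCoreBands` block (single-mode `λ_max ≥ cN`, super-`√N` single modes, bands of `o(N)` LOWEST modes, by arguments valid verbatim for the impenetrable ring gas in the thermodynamic limit) AND, in addition, every such argument whose conclusion is generalised condensation into an ARBITRARY family / subspace of `M_N = o(N/log N)` one-particle modes not tied to low momenta — e.g. a first step "some `M_N = N^{1-δ}` orthonormal modes carry `≥ εN` particles" obtained by compactness, entropy or pigeonhole arguments that do not locate the modes, followed by a `d = 3` concentration step — false for Girardeau's gas, where ANY `M` plane waves carry at most `7e√(NM(1 + log M))` particles for every `N` (typed here); for a general rank-`M` projection `P` the occupation `Tr Pγ_N = ∑_m c_m w_m` with `0 ≤ w_m ≤ 1`, `∑_m w_m = M` (`γ_N` is diagonal in the plane waves; Bessel), so by `c_m ≥ 0` it is at most the sum of the `M` largest `c_m` — this Ky Fan reduction, paper-level at the sixteenth audit, is TYPED since the seventeenth audit (2026-08-17) in the companion `OneDimensionalHardCoreSubspaces.lean` (`hasSum_momentumOccupation_mul_sq_ezCoeff`, `mul_sum_sq_ezCoeff_family_le_one`, `exists_card_le_sum_mul_le`,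 `subspaceOccupation_le`: every orthonormal family of `M` square-integrable modes carries at most `7e√N√(M(1 + log M))` particles, all `N`, `L`)
because: Lenard's Toeplitz formula per mode makes `F_A(n+1) = (2π)⁻¹∫₀^{2π} R(n,t)K_A(t)dt`, `K_A = ∑_{m∈A}cos(mt)` (`familyOccupation_succ_eq_integral`); `|K_A| ≤ M` and the orthogonality bound `∫₀^{2π}K_A² = π(M + #{m ∈ A : −m ∈ A}) ≤ 2πM` (`integral_familyKernel_sq_le`); Szegő's inequality `R(n,t) ≤ 2e√(n+1)/√|sin(t/2)|` (`lenardDet_le_sqrt`, [cite: DeiftItsKrasovsky2013, Remark 8 (r34-2)]) gives `∫_{dist(t,2πℤ) ≤ π/M} R|K_A| ≤ 8eπ√((n+1)M)` and, by Cauchy–Schwarz on the two remaining half periods, `≤ 2√(4e²(n+1)π(1 + log M))·√(2πM)` there (`integral_half_family_le`, `integral_lenardDet_mul_abs_familyKernel_le`); the logarithm is the true size of `∫R² = 2π∑_m c_m² ≍ N log N` given `c_m ≍ √(N/m)`, so removing it needs the shape of `K_A` (bands: Dirichlet-kernel decay, `OneDimensionalHardCoreBands`) or the monotonicity of `c_m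`
evasions_known: exactly those of `OneDimensionalHardCore` (i)–(x): use `d = 3` essentially, or a weak-coupling (Gross–Pitaevskii / Bogoliubov) mechanism; families of `Θ(N/log N) … Θ(N)` modes are NOT excluded by anything typed (`∑_m c_m = N`: families of `Θ(N)` modes do carry `Θ(N)` particles, and the window `N/log N ≲ M_N = o(N)` is open in the tree, closed on paper only modulo the monotonicity of `c_m`)
scope_caveats: (a) typed for the ZERO-RANGE impenetrable gas on the PERIODIC ring and, in this file, families of PLANE WAVES only; arbitrary orthonormal families / rank-`M` projections reduce to plane-wave families by the Ky Fan / Bessel step quoted in `blocks:`, typed since the seventeenth audit (2026-08-17) in `OneDimensionalHardCoreSubspaces.lean` (`subspaceOccupation_le`, square-integrable modes; before it the tree had only the single-mode Schur bound `norm_girardeauForm_le_zeroMomentumOccupation`, i.e. families of `o(√N)` arbitrary modes); (b) hard rods, walls and traps: not typed in family form; (c) the constant `7e` and the factor `√(1 + log M)` are artefacts of the proof (printed order `√(NM)` for the lowest modes [cite: ForresterEtAl2003, §2.2.2]); (d) [cite: Lenard1964, as restated in DeiftItsKrasovsky2013 Remark 8] not re-read (cite-only, acq-00347)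
status: established (proved below, `oneDimensionalHardCoreFamilies_holds`, from the tree's Szegő–Lenard bound; sixteenth audit of `OneDimensionalHardCore`, 2026-08-17)
[cite: ForresterEtAl2003, §2.2.2] [cite: DeiftItsKrasovsky2013, Remark 8 (r34-1)–(r34-2)] -/
def OneDimensionalHardCoreFamilies : Prop :=
  ∀ L : ℝ, 0 < L → ∀ A : ℕ → Finset ℤ,
    Tendsto (fun N : ℕ => ((A N).card : ℝ) * (1 + Real.log (A N).card) / N) atTop (𝓝 0) →
      Tendsto (fun N : ℕ => familyOccupation N L (A N) / N) atTop (𝓝 0)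

/-- **The family barrier holds** (from `tendsto_familyOccupation_div`).
[cite: ForresterEtAl2003, §2.2.2] [cite: DeiftItsKrasovsky2013, Remark 8 (r34-1)–(r34-2)] -/
theorem oneDimensionalHardCoreFamilies_holds : OneDimensionalHardCoreFamilies :=
  fun _ hL _ hA => tendsto_familyOccupation_div hL hA

/-- Consistency with the parent entry: the family barrier at `A_N ≡ {0}` is `c₀(N)/N → 0`, i.e.
`OneDimensionalHardCore`. [cite: ForresterEtAl2003, §2.2.2] -/
theorem oneDimensionalHardCore_of_families (h : OneDimensionalHardCoreFamilies) :
    OneDimensionalHardCore := by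
  intro L hL
  have h0 := h L hL (fun _ => {0}) (by
    simp only [Finset.card_singleton, Nat.cast_one, Real.log_one, add_zero, mul_one]
    exact tendsto_const_div_atTop_nhds_zero_nat 1)
  refine h0.congr' (Eventually.of_forall fun N => ?_)
  simp only
  rw [familyOccupation_singleton_zero hL]

end Literature.Barriers.AtomisticToContinuum

end
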